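/-
Copyright (c) 2026 the pub-hodgecm-mathlib formalisation cell (harness21).  Prover seat hodgecm-mathlib-K2Liu-p07 (g3), Track B «K2-LIT»,
#184♮ = hLiu418 = `stmt-HodgeConjecture-24832`; #42S payer road, organ S1 (local Siegel–Weil spanning), ROAD W, file F5′-A (LEAD F0P6-plan (g14)
RULING «M-158a» (4): the SIMILITUDE TRANSPORT currency of K2Liu-p06 (g4) 10:28:35Z (R3) ∕ 10:31:36Z (2); census K2Liu-p07 (g3) 10:4xZ on `K2/STATUS.md`).
-/
import Literature.NumberTheory.GelbartRogawski1991.LocalDoubledRationalSimilitudeSymplectic   -- ★ P3b: `resAut_toLocalGL_map`, `coe_localPiEquiv_localCongr`, `exists_symplectic_kd` pattern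
import Literature.NumberTheory.GelbartRogawski1991.LocalDoubledUnitaryIwahori                  -- ★ `isSiegelDelta_iff_blkC_eq_zero`, `adapt`∕`matA` calculus
import Literature.NumberTheory.GelbartRogawski1991.LocalDoubledUnitaryKudlaSplitting           -- ★ `detDelta_eq` (`det_Δ g = det (A_g + C_g)`)
import HarnessLib

/-!
# Crux `HLiu418`, #42S organ S1, ROAD W, file F5′-A: THE `Δ`-SIMILITUDE `d_a = (1 on Δ, a on ∇)` OF THE DOUBLED SPACE AND THE AUTOMORPHISM `Ad(d_a)` OF
# `H(F_v) = U(𝕍 ⊕ −𝕍)(F_v)` — adapted blocks, the Siegel parabolic, `det_Δ` and the big cell under `Ad(d_a)`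

Cell `hodgecm-mathlib`, crux item hLiu418 = `stmt-HodgeConjecture-24832`; squad K2 ∕ K2Liu; LEAD F0P6-plan (g14), organ lead K2Liu-p06 (g4); prover
K2Liu-p07 (g3).  THEOREMS ONLY (no `def`, no instance, no notation, no named-fact hypothesis, no `sorry`); lane `--supports stmt-HodgeConjecture-24832 --as helper`.

WHY (ruling «M-158a» (4), K2Liu-p06 (g4)'s reformulation (R3)).  Organ S1 proves `I_v(½, χ_v) = R₂(V⁺_v) + R₂(V⁻_v)`.  Since `dim V′ = 3` is odd, `V⁻ ≅ (V⁺, a·h)`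
for `a ∈ L⁺ˣ` a local non-norm at `v`, and the Weil representation of `(V′, a·h)` is that of `V′` at `ψ_a`; `ψ ↦ ψ_a` is conjugation by the SIMILITUDE
`d_a := (1 on Δ, a on ∇) ∈ GU(𝔻)(F_v)` (multiplier `a`), which normalises `P_Δ`.  Every `V⁻`-side statement of ROAD W thus becomes a `V⁺`-internal statement
transported along `Ad(d_a)`.  In the tree `Ad(d_a)` needs NO new definition: `d_a` is the `F`-rational matrix `D₀ = e₂ ∘ R·diag(1, a)·R⁻¹` (`R` = ★ `cayR`, the
adapted frame), `ᵗD₀ · T^𝔻 · D₀ = a · T^𝔻` (`transpose_dA_mul_gramD_mul_dA`), so `Ad(d_a) = ★ localCongr E c DA (a⁻¹) (formCongr_dA) v` ([PlatonovRapinchuk1994, §2.3]).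
This file is the matrix layer (the exact analogue of ★ P3a `LocalDoubledRationalSimilitudeSiegel` + ★ P3b `…Symplectic` for `KD := DA` in place of `k ⊕ k`):
* §0 block algebra of `S_a := R·diag(1, a·1)·R⁻¹` over any commutative ring (`simMat_mul`, `adapt_simMat_conj`, `transpose_simMat_mul_fromBlocks_mul_simMat`);
* §1 the letter `D₀ : GL_{n+n}(F)` with `(D₀ : Matrix) = reindex e₂ e₂ S_a` (`exists_dA`: it exists), `transpose_dA_mul_gramD_mul_dA`, **`formCongr_dA`**;
* §2 `Ad(DA)` on adapted matrices: **`adapt_matA_localCongr_dA`** (`[[A,B],[C,D]] ↦ [[A, a⁻¹B],[aC, D]]`), hence **`isSiegelDelta_localCongr_dA_iff`** (`P_Δ` is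
  `Ad(d_a)`-stable), `blkC_matA_localCongr_dA`∕`isUnit_blkC_localCongr_dA_iff` (the big cell `{C invertible}` is `Ad(d_a)`-stable), and ON `P_Δ`:
  **`detDelta_localCongr_dA`**, **`chiDet_localCongr_dA`**, `norm_detDelta_localCongr_dA` (`d_a` is the identity on `Δ`);
* (sequel F5′-A2 `K2LiuLocalSWSimilitudeSymplectic`: the symplectic element `P_a := Res(DA_v) ∘ e′_a⁻¹ ∈ Sp(𝕎^𝔻_v, β_{T^𝔻})` and `P_a ℓ_Δ = ℓ_Δ` — the inputs of
  the P3c-type Kudla rigidity `P̃_a⁻¹ Σ_χ(Ad(d_a) g) P̃_a = scaleTransport_a(Σ′_χ)(g)` of file F5′-B; ★ `conj_iota_lineDelta_eq_iota_localCongr_kd` is generic in the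
  similitude and applies verbatim.)
References: [Kudla1994] §2 (the Siegel parabolic of the doubled space), §3 Thm. 3.1; [HarrisKudlaSweet1996] §1 (1.9)–(1.11), (1.15); [MoeglinVignerasWaldspurger1987]
Chap. 1 I.17 (similitudes), Chap. 2 II.1 (`ψ ↦ ψ_a`); [PlatonovRapinchuk1994] §2.3; [Weil1964] n° 34 p. 182 (`e′_a`).
HONEST LABEL.  Count-neutral helper: `HC_CM` is proved only modulo the 7 printed citations (2 remaining named inputs: hLiu418 = `stmt-HodgeConjecture-24832`,
h413 = `stmt-HodgeConjecture-24833`) until rung 0 closes.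
-/

set_option autoImplicit false
set_option linter.dupNamespace false -- the mandated namespace repeats `HodgeConjecture.HodgeConjecture`

noncomputable section

open scoped Matrix
open NumberField IsDedekindDomain Matrix
open Literature.NumberTheory.Automorphic Literature.NumberTheory.Automorphic.UnitaryGroup Literature.NumberTheory.Weil1964
open Literature.NumberTheory.GelbartRogawski1991.AdaptedBlocks
open Literature.NumberTheory.GelbartRogawski1991.UnitaryDualPair.LocalSplitting
open Literature.RepresentationTheory.HeisenbergGroup

namespace Summit.HodgeConjecture.HodgeConjecture.Cruxes.HLiu418.K2LiuLocalSWSimilitudeAlgebra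

/-! ## §0 Block algebra of `S_a = R · diag(1, a·1) · R⁻¹` -/

section Blocks

variable {R : Type*} [CommRing R] {ι : Type*} [DecidableEq ι]

/-- coercion of `GeneralLinearGroup.map` (definitional). [folklore] -/
private theorem coe_glMap {S : Type*} [CommRing S] {l : Type*} [Fintype l] [DecidableEq l] (f : R →+* S) (g : GL l R) :
    ((Matrix.GeneralLinearGroup.map f g : GL l S) : Matrix l l S) = (g : Matrix l l R).map f := rfl

/-- transposes of the adapted frame: `ᵗR = R`. [cite: HarrisKudlaSweet1996, §1 (1.11)] -/
theorem transpose_cayR : (cayR R ι)ᵀ = cayR R ι := by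
  simp only [cayR, Matrix.fromBlocks_transpose, Matrix.transpose_one, Matrix.transpose_neg]

variable [Fintype ι] [Invertible (2 : R)]

/-- **`S_a = [[α, β], [β, α]]`, `α = ½(1+a)`, `β = ½(1−a)`** (scalar blocks): the matrix of `d_a = (1 on Δ, a on ∇)` in the frame `(𝕍, −𝕍)`.
[cite: Kudla1994, §2] -/
theorem simMat_eq_fromBlocks (a : R) :
    cayR R ι * Matrix.fromBlocks 1 0 0 (a • (1 : Matrix ι ι R)) * cayRinv R ι =
      Matrix.fromBlocks ((⅟(2 : R) * (1 + a)) • (1 : Matrix ι ι R)) ((⅟(2 : R) * (1 - a)) • 1) ((⅟(2 : R) * (1 - a)) • 1) ((⅟(2 : R) * (1 + a)) • 1) := by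
  rw [cayRinv, cayR, Matrix.mul_smul, Matrix.fromBlocks_multiply, Matrix.fromBlocks_multiply, Matrix.fromBlocks_smul]
  simp only [Matrix.mul_one, Matrix.mul_zero, add_zero, zero_add, Matrix.mul_neg, Matrix.mul_smul]
  congr 1 <;> ext i j <;> simp only [Matrix.smul_apply, Matrix.add_apply, Matrix.neg_apply, Matrix.one_apply, smul_eq_mul, mul_ite, mul_one, mul_zero] <;>
    split_ifs <;> ring

/-- `S_a · S_b = S_{ab}`. [cite: Kudla1994, §2] -/
theorem simMat_mul (a b : R) :
    (cayR R ι * Matrix.fromBlocks 1 0 0 (a • (1 : Matrix ι ι R)) * cayRinv R ι) * (cayR R ι * Matrix.fromBlocks 1 0 0 (b • (1 : Matrix ι ι R)) * cayRinv R ι) =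
      cayR R ι * Matrix.fromBlocks 1 0 0 ((a * b) • (1 : Matrix ι ι R)) * cayRinv R ι := by
  calc (cayR R ι * Matrix.fromBlocks 1 0 0 (a • (1 : Matrix ι ι R)) * cayRinv R ι) * (cayR R ι * Matrix.fromBlocks 1 0 0 (b • (1 : Matrix ι ι R)) * cayRinv R ι)
      = cayR R ι * (Matrix.fromBlocks 1 0 0 (a • (1 : Matrix ι ι R)) * ((cayRinv R ι * cayR R ι) * Matrix.fromBlocks 1 0 0 (b • (1 : Matrix ι ι R)))) *
          cayRinv R ι := by simp only [Matrix.mul_assoc]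
    _ = _ := by
        rw [cayRinv_mul_cayR, Matrix.one_mul, Matrix.fromBlocks_multiply]
        simp only [Matrix.mul_zero, add_zero, zero_add, smul_zero, Matrix.mul_smul, Matrix.mul_one, smul_smul, mul_comm b a]

/-- `S_1 = 1`. [cite: Kudla1994, §2] -/
theorem simMat_one : cayR R ι * Matrix.fromBlocks 1 0 0 ((1 : R) • (1 : Matrix ι ι R)) * cayRinv R ι = 1 := by
  rw [one_smul, Matrix.fromBlocks_one, Matrix.mul_one, cayR_mul_cayRinv]

/-- `adapt S_a = diag(1, a·1)`. [cite: Kudla1994, §3] -/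
theorem adapt_simMat (a : R) : adapt (cayR R ι * Matrix.fromBlocks 1 0 0 (a • (1 : Matrix ι ι R)) * cayRinv R ι) = Matrix.fromBlocks 1 0 0 (a • 1) :=
  adapt_conj _

/-- **`Ad(d_a)` on adapted blocks**: `adapt (S_a M S_{a⁻¹}) = [[A, a⁻¹B], [aC, D]]` for `adapt M = [[A, B], [C, D]]` (`a` a unit).
[cite: Kudla1994, §3] -/
theorem adapt_simMat_conj (a : Rˣ) (M : Matrix (ι ⊕ ι) (ι ⊕ ι) R) :
    adapt ((cayR R ι * Matrix.fromBlocks 1 0 0 ((a : R) • (1 : Matrix ι ι R)) * cayRinv R ι) * M *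
        (cayR R ι * Matrix.fromBlocks 1 0 0 (((a⁻¹ : Rˣ) : R) • (1 : Matrix ι ι R)) * cayRinv R ι)) =
      Matrix.fromBlocks (blkA M) (((a⁻¹ : Rˣ) : R) • blkB M) ((a : R) • blkC M) (blkD M) := by
  rw [adapt_mul, adapt_mul, adapt_simMat, adapt_simMat, adapt_eq, Matrix.fromBlocks_multiply, Matrix.fromBlocks_multiply]
  simp only [Matrix.one_mul, Matrix.mul_one, Matrix.zero_mul, Matrix.mul_zero, add_zero, zero_add, Matrix.smul_mul, Matrix.mul_smul, smul_smul,
    Units.inv_mul, one_smul]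

/-- **the similitude identity** `ᵗS_a · (T ⊕ −T) · S_a = a · (T ⊕ −T)` (`d_a` scales the hyperbolic pairing of `Δ` with `∇` by `a`). [cite: MoeglinVignerasWaldspurger1987, Chap. 1 I.17]
[cite: HarrisKudlaSweet1996, §1 (1.9)] -/
theorem transpose_simMat_mul_fromBlocks_mul_simMat (a : R) (T : Matrix ι ι R) :
    (cayR R ι * Matrix.fromBlocks 1 0 0 (a • (1 : Matrix ι ι R)) * cayRinv R ι)ᵀ * Matrix.fromBlocks T 0 0 (-T) *
        (cayR R ι * Matrix.fromBlocks 1 0 0 (a • (1 : Matrix ι ι R)) * cayRinv R ι) =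
      a • Matrix.fromBlocks T 0 0 (-T) := by
  have h2 : ⅟(2 : R) * 2 = 1 := invOf_mul_self _
  rw [simMat_eq_fromBlocks, Matrix.fromBlocks_transpose, Matrix.fromBlocks_multiply, Matrix.fromBlocks_multiply, Matrix.fromBlocks_smul]
  simp only [Matrix.transpose_smul, Matrix.transpose_one, Matrix.smul_mul, Matrix.mul_smul, Matrix.one_mul, Matrix.mul_one, Matrix.mul_zero,
    smul_zero, add_zero, zero_add, Matrix.mul_neg, smul_neg, smul_smul]
  have k₁ : ⅟(2 : R) * (1 + a) * (⅟(2 : R) * (1 + a)) - ⅟(2 : R) * (1 - a) * (⅟(2 : R) * (1 - a)) = a := by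
    linear_combination (a * (⅟(2 : R) * 2 + 1)) * h2
  have k₂ : ⅟(2 : R) * (1 - a) * (⅟(2 : R) * (1 + a)) - ⅟(2 : R) * (1 + a) * (⅟(2 : R) * (1 - a)) = 0 := by ring
  have k₃ : ⅟(2 : R) * (1 + a) * (⅟(2 : R) * (1 - a)) - ⅟(2 : R) * (1 - a) * (⅟(2 : R) * (1 + a)) = 0 := by ring
  have k₄ : ⅟(2 : R) * (1 - a) * (⅟(2 : R) * (1 - a)) - ⅟(2 : R) * (1 + a) * (⅟(2 : R) * (1 + a)) = -a := by
    linear_combination (-(a * (⅟(2 : R) * 2 + 1))) * h2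
  congr 1
  · rw [← sub_eq_add_neg, ← sub_smul, k₁]
  · rw [← sub_eq_add_neg, ← sub_smul, k₂, zero_smul]
  · rw [← sub_eq_add_neg, ← sub_smul, k₃, zero_smul]
  · rw [← sub_eq_add_neg, ← sub_smul, k₄, neg_smul]

/-- a ring homomorphism between rings with `2` invertible maps `⅟2` to `⅟2`. [folklore] -/
theorem map_invOf_two {S : Type*} [CommRing S] [Invertible (2 : S)] (f : R →+* S) : f (⅟(2 : R)) = ⅟(2 : S) := by
  symm
  apply invOf_eq_right_inv
  rw [← map_ofNat f 2, ← map_mul, mul_invOf_self, map_one]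

/-- `S_a` is natural under ring homomorphisms: `S_a.map f = S_{f a}`. [cite: Kudla1994, §2] -/
theorem simMat_map {S : Type*} [CommRing S] [Invertible (2 : S)] (f : R →+* S) (a : R) :
    (cayR R ι * Matrix.fromBlocks 1 0 0 (a • (1 : Matrix ι ι R)) * cayRinv R ι).map f =
      cayR S ι * Matrix.fromBlocks 1 0 0 (f a • (1 : Matrix ι ι S)) * cayRinv S ι := by
  rw [simMat_eq_fromBlocks, simMat_eq_fromBlocks, Matrix.fromBlocks_map]
  have hsm : ∀ t : R, (t • (1 : Matrix ι ι R)).map f = f t • (1 : Matrix ι ι S) := fun t => by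
    rw [Matrix.smul_one_eq_diagonal, Matrix.smul_one_eq_diagonal, Matrix.diagonal_map (map_zero f)]
  simp only [hsm, map_mul, map_add, map_sub, map_one, map_invOf_two]

end Blocks

/-! ## §1 The rational similitude `D₀ = e₂ ∘ S_a` and `Ad(d_a) = localCongr DA` -/

variable (F : Type) [Field F] [NumberField F] (E : Type) [Field E] [NumberField E] [Algebra F E]
  (c : E ≃ₐ[F] E) (v : HeightOneSpectrum (𝓞 F)) (n : ℕ) {T₀ : Matrix (Fin n) (Fin n) F}
  {JD : Matrix (Fin (n + n)) (Fin (n + n)) E} (hJD : JD = (gramD F n T₀).map (algebraMap F E))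
  (a : Fˣ) {D₀ : GL (Fin (n + n)) F}
  (hD₀ : (D₀ : Matrix (Fin (n + n)) (Fin (n + n)) F) =
    Matrix.reindex (e₂ n) (e₂ n) (cayR F (Fin n) * Matrix.fromBlocks 1 0 0 ((a : F) • (1 : Matrix (Fin n) (Fin n) F)) * cayRinv F (Fin n)))
  {DA : GL (Fin (n + n)) E} (hDA : DA = Matrix.GeneralLinearGroup.map (algebraMap F E) D₀)

section Similitude

/-- **the letter `D₀` exists**: `e₂ ∘ S_a` is invertible with inverse `e₂ ∘ S_{a⁻¹}`. [cite: Kudla1994, §2] -/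
theorem exists_dA : ∃ D₀ : GL (Fin (n + n)) F, (D₀ : Matrix (Fin (n + n)) (Fin (n + n)) F) =
    Matrix.reindex (e₂ n) (e₂ n) (cayR F (Fin n) * Matrix.fromBlocks 1 0 0 ((a : F) • (1 : Matrix (Fin n) (Fin n) F)) * cayRinv F (Fin n)) := by
  refine ⟨⟨Matrix.reindex (e₂ n) (e₂ n) (cayR F (Fin n) * Matrix.fromBlocks 1 0 0 ((a : F) • (1 : Matrix (Fin n) (Fin n) F)) * cayRinv F (Fin n)),
    Matrix.reindex (e₂ n) (e₂ n) (cayR F (Fin n) * Matrix.fromBlocks 1 0 0 (((a⁻¹ : Fˣ) : F) • (1 : Matrix (Fin n) (Fin n) F)) * cayRinv F (Fin n)), ?_, ?_⟩, rfl⟩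
  · rw [Matrix.reindex_apply, Matrix.reindex_apply, Matrix.submatrix_mul_equiv, simMat_mul, Units.mul_inv, simMat_one, Matrix.submatrix_one_equiv]
  · rw [Matrix.reindex_apply, Matrix.reindex_apply, Matrix.submatrix_mul_equiv, simMat_mul, Units.inv_mul, simMat_one, Matrix.submatrix_one_equiv]

include hD₀ in
/-- **`ᵗD₀ · T^𝔻 · D₀ = a · T^𝔻`**: `d_a` is a similitude of `T^𝔻 = T₀ ⊕ (−T₀)` with multiplier `a`. [cite: MoeglinVignerasWaldspurger1987, Chap. 1 I.17]
[cite: HarrisKudlaSweet1996, §1 (1.9)] -/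
theorem transpose_dA_mul_gramD_mul_dA :
    (D₀ : Matrix (Fin (n + n)) (Fin (n + n)) F)ᵀ * gramD F n T₀ * (D₀ : Matrix (Fin (n + n)) (Fin (n + n)) F) = (a : F) • gramD F n T₀ := by
  rw [hD₀, gramD, Matrix.reindex_apply, Matrix.reindex_apply, Matrix.transpose_submatrix, Matrix.submatrix_mul_equiv, Matrix.submatrix_mul_equiv,
    transpose_simMat_mul_fromBlocks_mul_simMat, Matrix.submatrix_smul]
  rfl

omit [NumberField E] in
include hD₀ hDA hJD in
/-- **the similitude identity for ★ `localCongr`**: `ᵗ(c DA) · (a⁻¹ • J^𝔻) · DA = J^𝔻` (`DA` is `F`-rational, so `c DA = DA`) — hence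
`Ad(d_a) = localCongr E c DA _ (formCongr_dA …) v : H(F_v) ≃ₜ* H(F_v)`. [cite: PlatonovRapinchuk1994, §2.3] [cite: MoeglinVignerasWaldspurger1987, Chap. 1 I.17] -/
theorem formCongr_dA : formCongr (c : E →+* E) DA ((algebraMap F E (a : F))⁻¹ • JD) = JD := by
  subst hDA hJD
  rw [formCongr, coe_glMap, RingHom.coe_coe, Matrix.map_map]
  have hc : ((c : E → E)) ∘ (algebraMap F E) = algebraMap F E := funext fun x => c.commutes x
  rw [hc, Matrix.mul_smul, Matrix.smul_mul, ← Matrix.transpose_map, ← Matrix.map_mul, ← Matrix.map_mul,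
    transpose_dA_mul_gramD_mul_dA F n a hD₀, Matrix.map_smul' _ _ _ (map_mul (algebraMap F E)), smul_smul,
    inv_mul_cancel₀ ((map_ne_zero _).2 a.ne_zero), one_smul]

include hD₀ in
/-- the inverse letter: `(D₀⁻¹ : Matrix) = e₂ ∘ S_{a⁻¹}`. [cite: Kudla1994, §2] -/
theorem coe_inv_dA : ((D₀⁻¹ : GL (Fin (n + n)) F) : Matrix (Fin (n + n)) (Fin (n + n)) F) =
    Matrix.reindex (e₂ n) (e₂ n) (cayR F (Fin n) * Matrix.fromBlocks 1 0 0 (((a⁻¹ : Fˣ) : F) • (1 : Matrix (Fin n) (Fin n) F)) * cayRinv F (Fin n)) := by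
  apply Units.inv_eq_of_mul_eq_one_right
  rw [hD₀, Matrix.reindex_apply, Matrix.reindex_apply, Matrix.submatrix_mul_equiv, simMat_mul, Units.mul_inv, simMat_one, Matrix.submatrix_one_equiv]

end Similitude

/-! ## §2 `Ad(d_a)` on adapted matrices, on `P_Δ`, on `det_Δ`, on the big cell -/

section Adapted

variable {b : E} (hb : b ≠ 0) (hDAJ : formCongr (c : E →+* E) DA (b • JD) = JD)

include hD₀ hDA in
/-- the matrix of `DA_v` over `E ⊗ F_v`, `e₂`-reindexed, is `S_{a_v}` (`a_v = ι_v(a)`, `ι_v : F → F_v → E ⊗ F_v`). [cite: PlatonovRapinchuk1994, §5.1] -/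
theorem reindex_coe_toLocalGL_dA :
    Matrix.reindex (e₂ n).symm (e₂ n).symm ((toLocalGL E v DA).val : Matrix (Fin (n + n)) (Fin (n + n)) (LocalRing E v)) =
      cayR (LocalRing E v) (Fin n) * Matrix.fromBlocks 1 0 0 ((toLocalRing E v ((a : F) : v.adicCompletion F)) • (1 : Matrix (Fin n) (Fin n) (LocalRing E v))) *
        cayRinv (LocalRing E v) (Fin n) := by
  subst hDA
  rw [coe_toLocalGL_apply, coe_glMap, Matrix.map_map, hD₀, Matrix.reindex_apply, Matrix.reindex_apply, ← Matrix.submatrix_map, Matrix.submatrix_submatrix,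
    Equiv.symm_symm, Equiv.symm_comp_self, Matrix.submatrix_id_id, ← RingHom.coe_comp, simMat_map, RingHom.comp_apply, ← toLocalRing_coe]

include hD₀ hDA in
/-- the matrix of `DA_v⁻¹` over `E ⊗ F_v`, `e₂`-reindexed, is `S_{a_v⁻¹}`. [cite: PlatonovRapinchuk1994, §5.1] -/
theorem reindex_coe_toLocalGL_dA_inv :
    Matrix.reindex (e₂ n).symm (e₂ n).symm ((toLocalGL E v DA)⁻¹.val : Matrix (Fin (n + n)) (Fin (n + n)) (LocalRing E v)) =
      cayR (LocalRing E v) (Fin n) * Matrix.fromBlocks 1 0 0 ((toLocalRing E v (((a⁻¹ : Fˣ) : F) : v.adicCompletion F)) • (1 : Matrix (Fin n) (Fin n) (LocalRing E v))) *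
        cayRinv (LocalRing E v) (Fin n) := by
  rw [← map_inv]
  exact reindex_coe_toLocalGL_dA F E v n a⁻¹ (coe_inv_dA F n a hD₀) (by rw [hDA, map_inv])

include hD₀ hDA in
/-- **`matA (d_a p d_a⁻¹) = S_{a_v} · matA p · S_{a_v⁻¹}`** over `E ⊗ F_v` (★ `coe_localPiEquiv_localCongr`). [cite: PlatonovRapinchuk1994, §2.3] [cite: Kudla1994, §3] -/
theorem matA_localCongr_dA (p : UnitaryGroup.localPi E c (n + n) JD v) :
    matA F E c v n (localCongr E c DA hb hDAJ v p) =
      (cayR (LocalRing E v) (Fin n) * Matrix.fromBlocks 1 0 0 ((toLocalRing E v ((a : F) : v.adicCompletion F)) • (1 : Matrix (Fin n) (Fin n) (LocalRing E v))) *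
          cayRinv (LocalRing E v) (Fin n)) * matA F E c v n p *
        (cayR (LocalRing E v) (Fin n) * Matrix.fromBlocks 1 0 0 ((toLocalRing E v (((a⁻¹ : Fˣ) : F) : v.adicCompletion F)) • (1 : Matrix (Fin n) (Fin n) (LocalRing E v))) *
          cayRinv (LocalRing E v) (Fin n)) := by
  rw [← reindex_coe_toLocalGL_dA F E v n a hD₀ hDA, ← reindex_coe_toLocalGL_dA_inv F E v n a hD₀ hDA, matA, matA, matS, matS,
    coe_localPiEquiv_localCongr, Units.val_mul, Units.val_mul, Matrix.reindex_apply, Matrix.reindex_apply, Matrix.reindex_apply, Matrix.reindex_apply,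
    Matrix.submatrix_mul_equiv, Matrix.submatrix_mul_equiv]

include hD₀ hDA in
/-- **`Ad(d_a)` ON ADAPTED MATRICES**: `adapt (matA (d_a p d_a⁻¹)) = [[A, a⁻¹B], [aC, D]]` for `adapt (matA p) = [[A, B], [C, D]]` — `d_a` is the identity on `Δ` and the
homothety `a` on `∇`. [cite: Kudla1994, §3] [cite: HarrisKudlaSweet1996, §1 (1.11)] -/
theorem adapt_matA_localCongr_dA (p : UnitaryGroup.localPi E c (n + n) JD v) :
    adapt (matA F E c v n (localCongr E c DA hb hDAJ v p)) =
      Matrix.fromBlocks (blkA (matA F E c v n p)) ((toLocalRing E v (((a⁻¹ : Fˣ) : F) : v.adicCompletion F)) • blkB (matA F E c v n p))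
        ((toLocalRing E v ((a : F) : v.adicCompletion F)) • blkC (matA F E c v n p)) (blkD (matA F E c v n p)) := by
  have hinv : toLocalRing E v (((a⁻¹ : Fˣ) : F) : v.adicCompletion F) * toLocalRing E v ((a : F) : v.adicCompletion F) = 1 := by
    rw [toLocalRing_coe, toLocalRing_coe, ← map_mul, ← map_mul, Units.inv_mul, map_one, map_one]
  rw [matA_localCongr_dA F E c v n a hD₀ hDA hb hDAJ, adapt_mul, adapt_mul, adapt_simMat, adapt_simMat, adapt_eq, Matrix.fromBlocks_multiply,
    Matrix.fromBlocks_multiply]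
  simp only [Matrix.one_mul, Matrix.mul_one, Matrix.zero_mul, Matrix.mul_zero, add_zero, zero_add, Matrix.smul_mul, Matrix.mul_smul, smul_smul,
    hinv, one_smul]

include hD₀ hDA in
/-- the `C`-block: `C(d_a p d_a⁻¹) = a · C(p)`. [cite: Kudla1994, §3] -/
theorem blkC_matA_localCongr_dA (p : UnitaryGroup.localPi E c (n + n) JD v) :
    blkC (matA F E c v n (localCongr E c DA hb hDAJ v p)) = (toLocalRing E v ((a : F) : v.adicCompletion F)) • blkC (matA F E c v n p) := by
  rw [blkC_eq_toBlocks₂₁_adapt, adapt_matA_localCongr_dA F E c v n a hD₀ hDA hb hDAJ, Matrix.toBlocks_fromBlocks₂₁]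

include hD₀ hDA in
/-- the `A`-block: `A(d_a p d_a⁻¹) = A(p)`. [cite: Kudla1994, §3] -/
theorem blkA_matA_localCongr_dA (p : UnitaryGroup.localPi E c (n + n) JD v) :
    blkA (matA F E c v n (localCongr E c DA hb hDAJ v p)) = blkA (matA F E c v n p) := by
  have h := adapt_matA_localCongr_dA F E c v n a hD₀ hDA hb hDAJ p
  rw [adapt_eq] at h
  exact (Matrix.fromBlocks_inj.1 h).1

/-- `a_v = ι_v(a)` is a unit of `E ⊗ F_v`. [folklore] -/
theorem isUnit_toLocalRing_coe : IsUnit (toLocalRing E v ((a : F) : v.adicCompletion F)) :=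
  (a.isUnit.map (algebraMap F (v.adicCompletion F))).map (toLocalRing E v)

include hD₀ hDA in
/-- **`P_Δ` IS `Ad(d_a)`-STABLE**: `d_a p d_a⁻¹ ∈ P_Δ ↔ p ∈ P_Δ` (`P_Δ = {C = 0}`, ★ `isSiegelDelta_iff_blkC_eq_zero`, and `C ↦ a·C`).
[cite: Kudla1994, §2, §3] [cite: HarrisKudlaSweet1996, §1 (1.11)] -/
theorem isSiegelDelta_localCongr_dA_iff [Algebra.IsQuadraticExtension F E] {δ : E} (hcδ : c δ = -δ) (hδ : δ ≠ 0) {d : F}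
    (hd : δ * δ = algebraMap F E d) (hT₀ : T₀.IsSymm) (p : UnitaryGroup.localPi E c (n + n) JD v) :
    IsSiegelDelta F E c hcδ hδ hd v n hT₀ hJD (localCongr E c DA hb hDAJ v p) ↔ IsSiegelDelta F E c hcδ hδ hd v n hT₀ hJD p := by
  rw [isSiegelDelta_iff_blkC_eq_zero, isSiegelDelta_iff_blkC_eq_zero, blkC_matA_localCongr_dA F E c v n a hD₀ hDA hb hDAJ]
  constructor
  · intro h
    rw [← smul_zero (toLocalRing E v ((a : F) : v.adicCompletion F))] at h
    exact (isUnit_toLocalRing_coe F E v a).smul_left_cancel.1 h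
  · intro h
    rw [h, smul_zero]

include hD₀ hDA in
/-- **the big cell `{C invertible}` is `Ad(d_a)`-stable.** [cite: Kudla1994, §3] -/
theorem isUnit_blkC_localCongr_dA_iff (p : UnitaryGroup.localPi E c (n + n) JD v) :
    IsUnit (blkC (matA F E c v n (localCongr E c DA hb hDAJ v p))) ↔ IsUnit (blkC (matA F E c v n p)) := by
  rw [blkC_matA_localCongr_dA F E c v n a hD₀ hDA hb hDAJ, Matrix.isUnit_iff_isUnit_det, Matrix.isUnit_iff_isUnit_det, Matrix.det_smul,
    IsUnit.mul_iff, and_iff_right ((isUnit_toLocalRing_coe F E v a).pow _)]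

include hD₀ hDA in
/-- **`det_Δ (d_a p d_a⁻¹) = det_Δ p` FOR `p ∈ P_Δ`** (`d_a` is the identity on `Δ`; ★ `detDelta_eq`: `det_Δ g = det(A_g + C_g)`).
[cite: Kudla1994, §3] [cite: HarrisKudlaSweet1996, §1 (1.15)] -/
theorem detDelta_localCongr_dA [Algebra.IsQuadraticExtension F E] {δ : E} (hcδ : c δ = -δ) (hδ : δ ≠ 0) {d : F}
    (hd : δ * δ = algebraMap F E d) (hT₀ : T₀.IsSymm) {p : UnitaryGroup.localPi E c (n + n) JD v}
    (hp : IsSiegelDelta F E c hcδ hδ hd v n hT₀ hJD p) (w : PlacesOver E v) :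
    detDelta F E c v n w (localCongr E c DA hb hDAJ v p) = detDelta F E c v n w p := by
  have hC : blkC (matA F E c v n p) = 0 := (isSiegelDelta_iff_blkC_eq_zero F E c hcδ hδ hd v n hT₀ hJD p).1 hp
  rw [detDelta_eq, detDelta_eq, blkA_matA_localCongr_dA F E c v n a hD₀ hDA hb hDAJ, blkC_matA_localCongr_dA F E c v n a hD₀ hDA hb hDAJ, hC, smul_zero]

include hD₀ hDA in
/-- **`χ_v(det_Δ (d_a p d_a⁻¹)) = χ_v(det_Δ p)` for `p ∈ P_Δ`**, for every family of characters `χ_w`. [cite: HarrisKudlaSweet1996, §1 (1.15)] -/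
theorem chiDet_localCongr_dA [Algebra.IsQuadraticExtension F E] {δ : E} (hcδ : c δ = -δ) (hδ : δ ≠ 0) {d : F}
    (hd : δ * δ = algebraMap F E d) (hT₀ : T₀.IsSymm) (χv : ∀ w : PlacesOver E v, (w.1.adicCompletion E)ˣ →* ℂˣ)
    {p : UnitaryGroup.localPi E c (n + n) JD v} (hp : IsSiegelDelta F E c hcδ hδ hd v n hT₀ hJD p) :
    chiDet F E c v n χv (localCongr E c DA hb hDAJ v p) = chiDet F E c v n χv p := by
  classical
  unfold chiDet
  refine Finset.prod_congr rfl fun w _ => ?_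
  have e := detDelta_localCongr_dA F E c v n hJD a hD₀ hDA hb hDAJ hcδ hδ hd hT₀ hp w
  by_cases hu : IsUnit (detDelta F E c v n w p)
  · have hu' : IsUnit (detDelta F E c v n w (localCongr E c DA hb hDAJ v p)) := by rw [e]; exact hu
    have hunit : hu'.unit = hu.unit := Units.ext (by rw [IsUnit.unit_spec, IsUnit.unit_spec, e])
    rw [dif_pos hu', dif_pos hu, hunit]
  · have hu' : ¬ IsUnit (detDelta F E c v n w (localCongr E c DA hb hDAJ v p)) := by rw [e]; exact hu
    rw [dif_neg hu', dif_neg hu]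

include hD₀ hDA in
/-- the modulus `‖det_Δ‖` is `Ad(d_a)`-invariant on `P_Δ`. [cite: HarrisKudlaSweet1996, §1 (1.16)] -/
theorem norm_detDelta_localCongr_dA [Algebra.IsQuadraticExtension F E] {δ : E} (hcδ : c δ = -δ) (hδ : δ ≠ 0) {d : F}
    (hd : δ * δ = algebraMap F E d) (hT₀ : T₀.IsSymm) {p : UnitaryGroup.localPi E c (n + n) JD v}
    (hp : IsSiegelDelta F E c hcδ hδ hd v n hT₀ hJD p) (w : PlacesOver E v) :
    ‖detDelta F E c v n w (localCongr E c DA hb hDAJ v p)‖ = ‖detDelta F E c v n w p‖ := by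
  rw [detDelta_localCongr_dA F E c v n hJD a hD₀ hDA hb hDAJ hcδ hδ hd hT₀ hp w]

end Adapted

end Summit.HodgeConjecture.HodgeConjecture.Cruxes.HLiu418.K2LiuLocalSWSimilitudeAlgebra

end
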